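import Summits.ABC.ABC.Theorems.TowerFourSubLiouville.Negative.CriticalLineStep

/-!
# `TowerFourSubLiouville` (stmt-ABC-1649): the line point `(θ, φ) = (2/7, 12/7)` of the two-exponent diagram is FALSE

Part 2 of the cycle-16 module of the standing disprover (see `Negative.CriticalLineStep` for the mechanism and the overview).
The `z = 1` Padé step `(N+1)(8N+3)⁴ − N(8N+5)⁴ = 320N² + 320N + 81` fed with the value-`1` Pell–Bezout family of
`Negative.AxisBoundary` (`81·w₀·s⁴ = v·u⁴ + 1`, `v = 6s² − 1`, `3w₀ = 2s² + 1`, `u² = 3s² + 1`), divided by `3⁴` and TWISTED by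
`3⁴ ∣ w₀` (`3⁵ ∣ 2s² + 1`, Pell indices `≡ 121, 122 (mod 243)`), is the coprime family

  `(v, w, Y, Z) = (6s² − 1, (2s² + 1)/243, u·(8N + 5)/3, 3s·(8N + 3))`,  `N = v·u⁴`,  `wZ⁴ = vY⁴ + (320·N·w₀·s⁴ + 1)`

(`exists_lineFamily₁`), with the EXACT certificates `v⁷ ≤ Z²` (height `θ = 2/7`) and `a⁷ ≤ Z¹²` (value `φ = 12/7`).  First member:
`s = s₁₂₁` (69 digits).  Consequences (matrix of `Negative.TwoExponentDiagram` verbatim):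
* `not_ubq₂_of_twoSevenths_le`: **`UBQ₂(θ, φ)` is FALSE for every `θ ≥ 2/7`, `φ ≥ 12/7`**;
* `not_ubq₂_twoSevenths_twelveSevenths`: **the point `(2/7, 12/7)` ON the critical line `θ + φ = 2` is false** — the second such point
  after `(2, 0)` (p152685); `ABC` makes the open side `θ + φ < 2` true (p143568), so under `ABC` the row and the column through it are
  DECIDED: `ubq₂_row_iff_of_abc₁ : UBQ₂(θ, 12/7) ⟺ θ < 2/7`, `ubq₂_col_iff_of_abc₁ : UBQ₂(2/7, φ) ⟺ φ < 12/7`;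
* `lt_twelveSevenths_of_ubq₂`: unconditionally a TRUE point with `θ ≥ 2/7` has `φ < 12/7`.
Calibration, not a kill (the crux needs a diagonal point `(η, η)`, `η > 0`).
-/


-- `Summit.ABC.ABC` is the mandated summit-side namespace (CONVENTIONS §2); the duplicate is deliberate.
set_option linter.dupNamespace false

namespace Summit.ABC.ABC.Theorems.TowerFourSubLiouville.Negative

/-! ## The `z = 1` line family (twisted): `(v, w, Y, Z) = (6s² − 1, (2s²+1)/243, u(8N+5)/3, 3s(8N+3))`, `N = vu⁴` -/

/-- Base relation of the twisted family: `6561·w·s⁴ = v·u⁴ + 1` (`= N + 1`). -/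
theorem lineFamily₁_base {u s v w : ℕ} (hu : u ^ 2 = 3 * s ^ 2 + 1) (hv : v + 1 = 6 * s ^ 2)
    (hw : 243 * w = 2 * s ^ 2 + 1) : 6561 * (w * s ^ 4) = v * u ^ 4 + 1 := by
  have hu' : ((u : ℤ)) ^ 2 = 3 * (s : ℤ) ^ 2 + 1 := by exact_mod_cast hu
  have hv' : (v : ℤ) + 1 = 6 * (s : ℤ) ^ 2 := by exact_mod_cast hv
  have hw' : 243 * (w : ℤ) = 2 * (s : ℤ) ^ 2 + 1 := by exact_mod_cast hw
  have : (6561 : ℤ) * ((w : ℤ) * (s : ℤ) ^ 4) = (v : ℤ) * (u : ℤ) ^ 4 + 1 := by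
    linear_combination (27 * (s : ℤ) ^ 4) * hw' - ((u : ℤ) ^ 4) * hv'
      - ((6 * (s : ℤ) ^ 2 - 1) * ((u : ℤ) ^ 2 + 3 * (s : ℤ) ^ 2 + 1)) * hu'
  exact_mod_cast this

/-- **The identity of the `z = 1` line family**: `w·(3s(8N+3))⁴ = v·(uM)⁴ + (25920·N·w·s⁴ + 1)`, `3M = 8N + 5`. -/
theorem lineFamily₁_identity {u s v w M : ℕ} (hu : u ^ 2 = 3 * s ^ 2 + 1) (hv : v + 1 = 6 * s ^ 2)
    (hw : 243 * w = 2 * s ^ 2 + 1) (hM : 3 * M = 8 * (v * u ^ 4) + 5) :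
    w * (3 * s * (8 * (v * u ^ 4) + 3)) ^ 4 = v * (u * M) ^ 4 + (25920 * (v * u ^ 4) * (w * s ^ 4) + 1) := by
  have hB := lineFamily₁_base hu hv hw
  have hBq : (6561 : ℚ) * ((w : ℚ) * (s : ℚ) ^ 4) = (v : ℚ) * (u : ℚ) ^ 4 + 1 := by exact_mod_cast hB
  have hMq : 3 * (M : ℚ) = 8 * ((v : ℚ) * (u : ℚ) ^ 4) + 5 := by exact_mod_cast hM
  have key : (w : ℚ) * (3 * s * (8 * ((v : ℚ) * (u : ℚ) ^ 4) + 3)) ^ 4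
      = v * ((u : ℚ) * M) ^ 4 + (25920 * ((v : ℚ) * (u : ℚ) ^ 4) * ((w : ℚ) * (s : ℚ) ^ 4) + 1) := by
    linear_combination
      (((8 * ((v : ℚ) * (u : ℚ) ^ 4) + 3) ^ 4 - 320 * ((v : ℚ) * (u : ℚ) ^ 4)) / 81) * hBq
      - ((((v : ℚ) * (u : ℚ) ^ 4) * (27 * (M : ℚ) ^ 3 + 9 * (M : ℚ) ^ 2 * (8 * ((v : ℚ) * (u : ℚ) ^ 4) + 5)
          + 3 * (M : ℚ) * (8 * ((v : ℚ) * (u : ℚ) ^ 4) + 5) ^ 2 + (8 * ((v : ℚ) * (u : ℚ) ^ 4) + 5) ^ 3)) / 81) * hMq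
  exact_mod_cast key

/-- **Coprimality of the `z = 1` line family** (`gcd(vY, wZ) = 1`; the only delicate prime is `3`: `3 ∤ v`, `3 ∤ u`, and
`M = (8N+5)/3 ≡ −1 (mod 27)` is handled by `M + 1 = 17496·w·s⁴`). -/
theorem lineFamily₁_coprime {u s v w M : ℕ} (hu : u ^ 2 = 3 * s ^ 2 + 1) (hv : v + 1 = 6 * s ^ 2)
    (hw : 243 * w = 2 * s ^ 2 + 1) (hM : 3 * M = 8 * (v * u ^ 4) + 5) :
    Nat.Coprime (v * (u * M)) (w * (3 * s * (8 * (v * u ^ 4) + 3))) := by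
  have hB := lineFamily₁_base hu hv hw
  have hBz : (6561 : ℤ) * ((w : ℤ) * (s : ℤ) ^ 4) = (v : ℤ) * (u : ℤ) ^ 4 + 1 := by exact_mod_cast hB
  have hMz : 3 * (M : ℤ) = 8 * ((v : ℤ) * (u : ℤ) ^ 4) + 5 := by exact_mod_cast hM
  have hM' : M + 1 = 17496 * (w * s ^ 4) := by omega
  have hM'z : (M : ℤ) + 1 = 17496 * ((w : ℤ) * (s : ℤ) ^ 4) := by exact_mod_cast hM'
  -- (a) `gcd(vu, 3ws) = 1` from the value-`1` base relation
  have ha : Nat.Coprime (v * u) (w * (3 * s)) :=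
    coprime_of_int_combination (a := -((u : ℤ) ^ 3)) (b := 2187 * (s : ℤ) ^ 3) (r := 1)
      (by push_cast; linear_combination hBz) (Nat.coprime_one_left _)
  -- (b) `gcd(vu, 8N+3) ∣ 3` and `3 ∤ vu`
  have h3v : ¬ 3 ∣ v := by omega
  have h3u : ¬ 3 ∣ u := by
    intro h3
    have : 3 ∣ u ^ 2 := dvd_pow h3 two_ne_zero
    omega
  have h3vu : Nat.Coprime 3 (v * u) :=
    Nat.Coprime.mul_right ((Nat.Prime.coprime_iff_not_dvd Nat.prime_three).mpr h3v)
      ((Nat.Prime.coprime_iff_not_dvd Nat.prime_three).mpr h3u)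
  have hb : Nat.Coprime (v * u) (8 * (v * u ^ 4) + 3) :=
    coprime_of_int_combination (a := -(8 * (u : ℤ) ^ 3)) (b := 1) (r := 3) (by push_cast; ring) h3vu
  -- (c) `gcd(M, 3ws) = 1` from `M + 1 = 17496ws⁴`
  have hc : Nat.Coprime M (w * (3 * s)) :=
    coprime_of_int_combination (a := -1) (b := 5832 * (s : ℤ) ^ 3) (r := 1)
      (by push_cast; linear_combination (-1 : ℤ) * hM'z) (Nat.coprime_one_left _)
  -- (d) `gcd(M, 8N+3) ∣ 2` and `M` is odd
  have h2M : Nat.Coprime 2 M := (Nat.Prime.coprime_iff_not_dvd Nat.prime_two).mpr (by omega)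
  have hd : Nat.Coprime M (8 * (v * u ^ 4) + 3) :=
    coprime_of_int_combination (a := 3) (b := -1) (r := 2) (by push_cast; linear_combination hMz) h2M
  have h1 : Nat.Coprime (v * u) (w * (3 * s) * (8 * (v * u ^ 4) + 3)) := Nat.Coprime.mul_right ha hb
  have h2 : Nat.Coprime M (w * (3 * s) * (8 * (v * u ^ 4) + 3)) := Nat.Coprime.mul_right hc hd
  have h12 : Nat.Coprime (v * u * M) (w * (3 * s) * (8 * (v * u ^ 4) + 3)) := Nat.Coprime.mul_left h1 h2
  have e1 : v * (u * M) = v * u * M := by ring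
  have e2 : w * (3 * s * (8 * (v * u ^ 4) + 3)) = w * (3 * s) * (8 * (v * u ^ 4) + 3) := by ring
  rw [e1, e2]
  exact h12

/-- **Height certificate of the `z = 1` line family**: `v⁷ ≤ Z²` (`v ≈ (2/27)Z₀²·9`, `Z ≈ 1296 s⁷`; this is where the twist is spent). -/
theorem lineFamily₁_height {u s v : ℕ} (hu : u ^ 2 = 3 * s ^ 2 + 1) (hv : v + 1 = 6 * s ^ 2) :
    v ^ 7 ≤ (3 * s * (8 * (v * u ^ 4) + 3)) ^ 2 := by
  have hu4 := pell3_nine_mul_pow_four_le hu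
  have hv6 : v ≤ 6 * s ^ 2 := by omega
  have hZ : 216 * (v * s ^ 5) ≤ 3 * s * (8 * (v * u ^ 4) + 3) := by
    have e : 3 * s * (8 * (v * u ^ 4) + 3) = 24 * s * (v * u ^ 4) + 9 * s := by ring
    calc 216 * (v * s ^ 5) = 24 * s * (v * (9 * s ^ 4)) := by ring
      _ ≤ 24 * s * (v * u ^ 4) := by gcongr
      _ ≤ 24 * s * (v * u ^ 4) + 9 * s := Nat.le_add_right _ _
      _ = 3 * s * (8 * (v * u ^ 4) + 3) := e.symm
  calc v ^ 7 = v ^ 2 * v ^ 5 := by ring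
    _ ≤ v ^ 2 * (6 * s ^ 2) ^ 5 := by gcongr
    _ = 7776 * (v ^ 2 * s ^ 10) := by ring
    _ ≤ 46656 * (v ^ 2 * s ^ 10) := Nat.mul_le_mul_right _ (by norm_num)
    _ = (216 * (v * s ^ 5)) ^ 2 := by ring
    _ ≤ (3 * s * (8 * (v * u ^ 4) + 3)) ^ 2 := Nat.pow_le_pow_left hZ 2

/-- **Value certificate of the `z = 1` line family**: `a⁷ ≤ Z¹²` for `a = 25920·N·w·s⁴ + 1` (`a ≈ 11520 s¹²`, `Z^{12/7} ≈ 2·10⁵ s¹²`). -/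
theorem lineFamily₁_value {u s v w : ℕ} (hu : u ^ 2 = 3 * s ^ 2 + 1) (hv : v + 1 = 6 * s ^ 2)
    (hw : 243 * w = 2 * s ^ 2 + 1) (hu0 : 0 < u) :
    (25920 * (v * u ^ 4) * (w * s ^ 4) + 1) ^ 7 ≤ (3 * s * (8 * (v * u ^ 4) + 3)) ^ 12 := by
  have hu4 := pell3_nine_mul_pow_four_le hu
  have hs1 : 1 ≤ s := by
    rcases Nat.eq_zero_or_pos s with h0 | h0
    · subst h0; simp at hw
    · exact h0
  have hs0 : 0 < s := hs1
  have hs2 : 1 ≤ s ^ 2 := Nat.one_le_pow _ _ hs0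
  have hv0 : 0 < v := by omega
  have hv5 : 5 * s ^ 2 ≤ v := by omega
  have hw81 : 81 * w ≤ s ^ 2 := by omega
  have hA : 81 * (w * s ^ 4) ≤ s ^ 6 := by
    calc 81 * (w * s ^ 4) = (81 * w) * s ^ 4 := by ring
      _ ≤ s ^ 2 * s ^ 4 := Nat.mul_le_mul_right _ hw81
      _ = s ^ 6 := by ring
  have hN45 : 45 * s ^ 6 ≤ v * u ^ 4 := by
    calc 45 * s ^ 6 = (5 * s ^ 2) * (9 * s ^ 4) := by ring
      _ ≤ v * u ^ 4 := Nat.mul_le_mul hv5 hu4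
  have hpos : 1 ≤ s ^ 6 * (v * u ^ 4) := Nat.one_le_iff_ne_zero.mpr (by positivity)
  have ha : 25920 * (v * u ^ 4) * (w * s ^ 4) + 1 ≤ 321 * (s ^ 6 * (v * u ^ 4)) := by
    calc 25920 * (v * u ^ 4) * (w * s ^ 4) + 1 = 320 * (v * u ^ 4) * (81 * (w * s ^ 4)) + 1 := by ring
      _ ≤ 320 * (v * u ^ 4) * s ^ 6 + s ^ 6 * (v * u ^ 4) := add_le_add (Nat.mul_le_mul_left _ hA) hpos
      _ = 321 * (s ^ 6 * (v * u ^ 4)) := by ring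
  have hZ : 24 * (s * (v * u ^ 4)) ≤ 3 * s * (8 * (v * u ^ 4) + 3) := by
    have e : 3 * s * (8 * (v * u ^ 4) + 3) = 24 * (s * (v * u ^ 4)) + 9 * s := by ring
    rw [e]; exact Nat.le_add_right _ _
  calc (25920 * (v * u ^ 4) * (w * s ^ 4) + 1) ^ 7
      ≤ (321 * (s ^ 6 * (v * u ^ 4))) ^ 7 := Nat.pow_le_pow_left ha 7
    _ = 321 ^ 7 * (s ^ 42 * (v * u ^ 4) ^ 7) := by ring
    _ ≤ (24 ^ 12 * 45 ^ 5) * (s ^ 42 * (v * u ^ 4) ^ 7) := Nat.mul_le_mul_right _ (by norm_num)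
    _ = 24 ^ 12 * (s ^ 12 * (v * u ^ 4) ^ 7) * (45 * s ^ 6) ^ 5 := by ring
    _ ≤ 24 ^ 12 * (s ^ 12 * (v * u ^ 4) ^ 7) * (v * u ^ 4) ^ 5 := by gcongr
    _ = (24 * (s * (v * u ^ 4))) ^ 12 := by ring
    _ ≤ (3 * s * (8 * (v * u ^ 4) + 3)) ^ 12 := Nat.pow_le_pow_left hZ 12

/-- **The `z = 1` line family packaged**: beyond every bound a coprime quadruple with `wZ⁴ = vY⁴ + a`, `0 < a`,
height `max(v, w) = v`, and the two exact certificates `v⁷ ≤ Z²`, `a⁷ ≤ Z¹²` of the line point `(2/7, 12/7)`. -/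
theorem exists_lineFamily₁ (B : ℕ) : ∃ v w Y Z a : ℕ, B ≤ Z ∧ 1 ≤ Z ∧ 0 < v ∧ 0 < w ∧ 0 < Y ∧ 0 < a ∧
    Nat.Coprime (v * Y) (w * Z) ∧ w * Z ^ 4 = v * Y ^ 4 + a ∧ w ≤ v ∧ v ^ 7 ≤ Z ^ 2 ∧ a ^ 7 ≤ Z ^ 12 := by
  obtain ⟨u, s, hu, hBs, hs243⟩ := pell3_twist243_exists_ge (max B 1)
  have hB' : B ≤ s := le_trans (le_max_left _ _) hBs
  obtain ⟨w, hw⟩ := hs243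
  have hw' : 243 * w = 2 * s ^ 2 + 1 := hw.symm
  obtain ⟨v, hv⟩ : ∃ v : ℕ, v + 1 = 6 * s ^ 2 := ⟨6 * s ^ 2 - 1, by omega⟩
  have hu0 : 0 < u := by
    rcases Nat.eq_zero_or_pos u with h0 | h0
    · subst h0; simp at hu
    · exact h0
  have hBase := lineFamily₁_base hu hv hw'
  obtain ⟨M, hM⟩ : ∃ M : ℕ, 3 * M = 8 * (v * u ^ 4) + 5 := ⟨17496 * (w * s ^ 4) - 1, by omega⟩
  have hM0 : 0 < M := by omega
  have e : 3 * s * (8 * (v * u ^ 4) + 3) = 24 * (s * (v * u ^ 4)) + 9 * s := by ring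
  refine ⟨v, w, u * M, 3 * s * (8 * (v * u ^ 4) + 3), 25920 * (v * u ^ 4) * (w * s ^ 4) + 1, by omega, by omega,
    by omega, by omega, Nat.mul_pos hu0 hM0, Nat.succ_pos _, lineFamily₁_coprime hu hv hw' hM,
    lineFamily₁_identity hu hv hw' hM, by omega, lineFamily₁_height hu hv, lineFamily₁_value hu hv hw' hu0⟩

/-! ## The line point `(2/7, 12/7)` and its lobe -/

/-- **`UBQ₂(θ, φ)` fails for every `θ ≥ 2/7` and every `φ ≥ 12/7`** — the corner `(2/7, 12/7)` lies ON the critical line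
`θ + φ = 2`, on whose open side `ABC` makes everything true (p143568). -/
theorem not_ubq₂_of_twoSevenths_le (θ φ : ℝ) (hθ : 2 / 7 ≤ θ) (hφ : 12 / 7 ≤ φ) :
    ¬ ∃ Z₀ : ℕ, ∀ v w Y Z : ℕ, Z₀ ≤ Z → 0 < v → 0 < w → 0 < Y → Nat.Coprime (v * Y) (w * Z) →
      ((max v w : ℕ) : ℝ) ≤ (Z : ℝ) ^ θ → w * Z ^ 4 ≠ v * Y ^ 4 →
      (Z : ℝ) ^ φ < |((w * Z ^ 4 : ℕ) : ℝ) - ((v * Y ^ 4 : ℕ) : ℝ)| := by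
  rintro ⟨Z₀, h⟩
  obtain ⟨v, w, Y, Z, a, hNZ, hZ1, hv, hw, hY, ha, hcop, hid, hwv, hv7, ha7⟩ := exists_lineFamily₁ Z₀
  have hZR : (1 : ℝ) ≤ Z := by exact_mod_cast hZ1
  have hmax : ((max v w : ℕ) : ℝ) ≤ (Z : ℝ) ^ θ := by
    rw [max_eq_left hwv]
    have h1 : (v : ℝ) ≤ (Z : ℝ) ^ ((2 : ℝ) / 7) := by
      have := natCast_le_rpow_div_of_pow_le (p := 2) (q := 7) (by norm_num) hv7
      norm_num at this
      exact this
    exact h1.trans (Real.rpow_le_rpow_of_exponent_le hZR hθ)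
  have hne : w * Z ^ 4 ≠ v * Y ^ 4 := by rw [hid]; omega
  have key := h v w Y Z hNZ hv hw hY hcop hmax hne
  have habs : |((w * Z ^ 4 : ℕ) : ℝ) - ((v * Y ^ 4 : ℕ) : ℝ)| = (a : ℝ) := by
    rw [hid]; push_cast
    rw [show (((v : ℝ) * (Y : ℝ) ^ 4 + (a : ℝ)) - (v : ℝ) * (Y : ℝ) ^ 4) = (a : ℝ) by ring]
    exact abs_of_nonneg (by positivity)
  rw [habs] at key
  have haR : (a : ℝ) ≤ (Z : ℝ) ^ ((12 : ℝ) / 7) := by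
    have := natCast_le_rpow_div_of_pow_le (p := 12) (q := 7) (by norm_num) ha7
    norm_num at this
    exact this
  have h2 : (Z : ℝ) ^ ((12 : ℝ) / 7) ≤ (Z : ℝ) ^ φ := Real.rpow_le_rpow_of_exponent_le hZR hφ
  linarith

/-- **The line point `(2/7, 12/7)` itself is false.** -/
theorem not_ubq₂_twoSevenths_twelveSevenths :
    ¬ ∃ Z₀ : ℕ, ∀ v w Y Z : ℕ, Z₀ ≤ Z → 0 < v → 0 < w → 0 < Y → Nat.Coprime (v * Y) (w * Z) →
      ((max v w : ℕ) : ℝ) ≤ (Z : ℝ) ^ (2 / 7 : ℝ) → w * Z ^ 4 ≠ v * Y ^ 4 →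
      (Z : ℝ) ^ (12 / 7 : ℝ) < |((w * Z ^ 4 : ℕ) : ℝ) - ((v * Y ^ 4 : ℕ) : ℝ)| :=
  not_ubq₂_of_twoSevenths_le (2 / 7) (12 / 7) le_rfl le_rfl

/-- **The row `φ = 12/7` DECIDED under `ABC`: `UBQ₂(θ, 12/7) ⟺ θ < 2/7`** (for every `θ ≥ 0`). -/
theorem ubq₂_row_iff_of_abc₁ (habc : ABC) {θ : ℝ} (hθ0 : 0 ≤ θ) :
    (∃ Z₀ : ℕ, ∀ v w Y Z : ℕ, Z₀ ≤ Z → 0 < v → 0 < w → 0 < Y → Nat.Coprime (v * Y) (w * Z) →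
      ((max v w : ℕ) : ℝ) ≤ (Z : ℝ) ^ θ → w * Z ^ 4 ≠ v * Y ^ 4 →
      (Z : ℝ) ^ (12 / 7 : ℝ) < |((w * Z ^ 4 : ℕ) : ℝ) - ((v * Y ^ 4 : ℕ) : ℝ)|) ↔ θ < 2 / 7 := by
  constructor
  · intro h
    by_contra hge
    push Not at hge
    exact not_ubq₂_of_twoSevenths_le θ (12 / 7) hge le_rfl h
  · intro hθ
    exact ubq₂_of_abc_sharp habc hθ0 (by linarith)

/-- **The column `θ = 2/7` DECIDED under `ABC`: `UBQ₂(2/7, φ) ⟺ φ < 12/7`.** -/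
theorem ubq₂_col_iff_of_abc₁ (habc : ABC) {φ : ℝ} :
    (∃ Z₀ : ℕ, ∀ v w Y Z : ℕ, Z₀ ≤ Z → 0 < v → 0 < w → 0 < Y → Nat.Coprime (v * Y) (w * Z) →
      ((max v w : ℕ) : ℝ) ≤ (Z : ℝ) ^ (2 / 7 : ℝ) → w * Z ^ 4 ≠ v * Y ^ 4 →
      (Z : ℝ) ^ φ < |((w * Z ^ 4 : ℕ) : ℝ) - ((v * Y ^ 4 : ℕ) : ℝ)|) ↔ φ < 12 / 7 := by
  constructor
  · intro h
    by_contra hge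
    push Not at hge
    exact not_ubq₂_of_twoSevenths_le (2 / 7) φ le_rfl hge h
  · intro hφ
    exact ubq₂_of_abc_sharp habc (by norm_num) (by linarith)

/-- Unconditionally: a TRUE point with `θ ≥ 2/7` has `φ < 12/7` (the line is crossed at `(2/7, 12/7)`). -/
theorem lt_twelveSevenths_of_ubq₂ {θ φ : ℝ} (hθ : 2 / 7 ≤ θ)
    (h : ∃ Z₀ : ℕ, ∀ v w Y Z : ℕ, Z₀ ≤ Z → 0 < v → 0 < w → 0 < Y → Nat.Coprime (v * Y) (w * Z) →
      ((max v w : ℕ) : ℝ) ≤ (Z : ℝ) ^ θ → w * Z ^ 4 ≠ v * Y ^ 4 →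
      (Z : ℝ) ^ φ < |((w * Z ^ 4 : ℕ) : ℝ) - ((v * Y ^ 4 : ℕ) : ℝ)|) : φ < 12 / 7 := by
  by_contra hge
  push Not at hge
  exact not_ubq₂_of_twoSevenths_le θ φ hθ hge h


end Summit.ABC.ABC.Theorems.TowerFourSubLiouville.Negative
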